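import Mathlib
import HarnessLib
import Literature.AlgebraicGeometry.RelativeSpec.FiniteGroupQuotientGluing
import Literature.AlgebraicGeometry.RelativeSpec.FiniteGroupQuotientUniversal
import Summits.ResolutionOfSingularities.ResolutionOfSingularities.Theorems.WildQuotientsWildQuotientResolutionS1aGameFrame

/-!
# S1a — A5c: (G5) END GLUING — a terminal cover by stable affine tame charts makes `V/G` locally tame-root-regular

(crux stmt-ResolutionOfSingularities-15640 `WildQuotients.WildQuotientResolution`, line `Sketch`; S1 =
stmt-ResolutionOfSingularities-17941 `CyclicQuotientFourfolds`, stub `stub_localGame`; S1a H3-scheme, idea-2 H4e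
`…S1aGameFrame` (`EndGluing`, residue (G5); tree copy lead-1 p575581); res-L1-w45c-plan-1 ASSIGN 2026-08-27T22:00:26Z
(A5c → res-D-pv-033). [OURS · L1 W4.5c] — NOT a statement of any manuscript; AI-produced, weaker than expert review.
Def-free. Prover res-D-pv-033.)

**`endGluing : EndGluing`.** The one point: for a `G`-stable open `O` which is AFFINE (not only affine over the
separated base `Y`), the piece quotient `O/G` of the tree (`ActionOver.quotient` = relative `Spec` over `Y` of the
invariants) is an AFFINE scheme with coordinate ring `Γ(O)^G` — `isAffine_pieceQuot_of_isAffineOpen`: compare, by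
the universal property of the tree's quotient (`ActionOver.desc`, separated targets), with the quotient of the SAME
action taken over the affine base `Spec ℤ`, which is affine (`isAffine_of_isAffineHom`) with global sections
`Γ(O)^G` (`SubringDatum.objIso` over `⊤`). Then the chart `O/G ↪ V/G` (`ActionOver.gluedι`, an open immersion) is an
affine open of `V/G` containing the image of `O`, with coordinate ring `≅ Γ(O)^G`, a tame root chart by hypothesis
(`IsTameRootChart.of_ringEquiv`).
-/

-- single-problem summit: the doubled namespace component `ResolutionOfSingularities` is forced
set_option linter.dupNamespace false

noncomputable section

open CategoryTheory CategoryTheory.Limits AlgebraicGeometry TopologicalSpace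
open Literature.AlgebraicGeometry.RelativeSpec
open Summit.ResolutionOfSingularities.ResolutionOfSingularities.Theorems.WildQuotientResolution.S1
open Summit.ResolutionOfSingularities.ResolutionOfSingularities.Theorems.WildQuotientResolution.S1.NodeAtlas

namespace Summit.ResolutionOfSingularities.ResolutionOfSingularities.Theorems.WildQuotientResolution.S1.GameFrame

universe u

/-! ## The piece quotient of an affine stable open is affine, with coordinate ring the invariants -/

/-- **`O/G` is affine with `Γ(O/G) ≅ Γ(O)^G` when `O` is affine** (any separated base). [folklore; Mumford AV §7
Thm. p. 66 / SGA 3 V.4.1, via the universal property] -/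
theorem isAffine_pieceQuot_of_isAffineOpen {V Y : Scheme.{u}} {r : V ⟶ Y} {G : Type u} [Group G] [Finite G]
    [Y.IsSeparated] [IsSeparated r] (act : ActionOver r G) (O : act.StableAffineOpens) (hO : IsAffineOpen O.1) :
    IsAffine (act.pieceQuot O) ∧
      Nonempty (Γ(act.pieceQuot O, ⊤) ≃+* ↥((act.restrict O.1 O.2.1).invariantsRing ⊤)) := by
  haveI : IsAffine (O.1 : Scheme.{u}) := hO
  -- the same action, over the affine base `Spec ℤ`
  let T : Scheme.{u} := Spec (.of (ULift.{u} ℤ))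
  let hT : IsTerminal T := specULiftZIsTerminal
  let r₂ : (O.1 : Scheme.{u}) ⟶ T := hT.from _
  let ρ₂ : ActionOver r₂ G := ⟨(act.restrict O.1 O.2.1).aut, fun g => hT.hom_ext _ _⟩
  haveI hA₂ : IsAffine ρ₂.quotient := isAffine_of_isAffineHom ρ₂.quotientToBase
  haveI : (act.restrict O.1 O.2.1).quotient.IsSeparated := act.isSeparated_pieceQuot O
  -- comparison morphisms from the two universal properties
  let φ : (act.restrict O.1 O.2.1).quotient ⟶ ρ₂.quotient :=
    (act.restrict O.1 O.2.1).desc ρ₂.toQuotient ρ₂.aut_hom_toQuotient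
  let ψ : ρ₂.quotient ⟶ (act.restrict O.1 O.2.1).quotient :=
    ρ₂.desc (act.restrict O.1 O.2.1).toQuotient (act.restrict O.1 O.2.1).aut_hom_toQuotient
  have h1 : φ ≫ ψ = 𝟙 _ := (act.restrict O.1 O.2.1).desc_unique (by
    rw [Category.comp_id, ← Category.assoc, ActionOver.toQuotient_desc, ActionOver.toQuotient_desc])
  have h2 : ψ ≫ φ = 𝟙 _ := ρ₂.desc_unique (by
    rw [Category.comp_id, ← Category.assoc, ActionOver.toQuotient_desc, ActionOver.toQuotient_desc])
  let e : (act.restrict O.1 O.2.1).quotient ≅ ρ₂.quotient := ⟨φ, ψ, h1, h2⟩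
  haveI : IsIso φ := e.isIso_hom
  refine ⟨IsAffine.of_isIso φ, ⟨?_⟩⟩
  -- sections: `Γ(O/G) ≅ Γ(ρ₂-quotient) ≅ invariants over ⊤`
  have eΓ : Γ((act.restrict O.1 O.2.1).quotient, ⊤) ≅ Γ(ρ₂.quotient, ⊤) := (Scheme.Γ.mapIso e.op).symm
  have eT : Γ(ρ₂.quotient, ρ₂.quotientToBase ⁻¹ᵁ ⊤) ≅ .of ↥(ρ₂.invariants.ring ⊤) :=
    ρ₂.invariants.objIso (isAffineOpen_top T)
  exact (eΓ ≪≫ eT).commRingCatIsoToRingEquiv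

/-! ## (G5) -/

/-- **(G5) END GLUING.** If every point of `V` lies in a `G`-stable open, affine and affine over the separated base,
whose ring of invariants is a tame root chart, then the glued quotient `V/G` is locally tame-root-regular.
[OURS · L1 W4.5c] -/
theorem endGluing : EndGluing := by
  intro V Y r G _ _ _ _ act H
  have hcov : ∀ x : V, ∃ O : act.StableAffineOpens, x ∈ O.1 := fun x => (H x).imp fun O h => h.1
  intro z
  obtain ⟨x, rfl⟩ := act.gluedMk_surjective hcov z
  obtain ⟨O, hxO, hOaff, htame⟩ := H x
  obtain ⟨hQ, ⟨eQ⟩⟩ := isAffine_pieceQuot_of_isAffineOpen act O hOaff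
  haveI := hQ
  refine ⟨⟨(act.gluedι O) ''ᵁ ⊤, (isAffineOpen_top (act.pieceQuot O)).image_of_isOpenImmersion (act.gluedι O)⟩,
    ?_, ?_⟩
  · change act.gluedMk hcov (⟨x, hxO⟩ : O.1).1 ∈ (act.gluedι O) ''ᵁ ⊤
    rw [act.gluedMk_apply hcov O ⟨x, hxO⟩]
    exact ⟨act.pieceMk O ⟨x, hxO⟩, trivial, rfl⟩
  · exact IsTameRootChart.of_ringEquiv
      ((((act.gluedι O).appIso ⊤).commRingCatIsoToRingEquiv).trans eQ) htame

end Summit.ResolutionOfSingularities.ResolutionOfSingularities.Theorems.WildQuotientResolution.S1.GameFrame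

end
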